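import Literature.AlgebraicGeometry.Resolution.AffineBlowupAlgebra
import Literature.AlgebraicGeometry.Resolution.ProjectiveSpaceRegular
import Literature.AlgebraicGeometry.Resolution.NormalizationOfVarietiesProofs
import Literature.AlgebraicGeometry.Resolution.RegularLocalRingsNormal
import Summits.ResolutionOfSingularities.ResolutionOfSingularities.Theorems.FrobeniusLadderFInjectiveMacaulayficationReesChartRing
import Summits.ResolutionOfSingularities.ResolutionOfSingularities.Theorems.SectionAscentFibrewiseClosedPointsOneShotCurvesDedekind
import Mathlib.RingTheory.Localization.AsSubring
import Mathlib.RingTheory.IntegralClosure.IntegrallyClosed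
import Mathlib.RingTheory.FiniteType
import HarnessLib

/-!
# One-shot resolution of affine curves: blowing up the conductor (`stub_oneShotCurves`)

Support file for crux stmt-ResolutionOfSingularities-15960 (`SectionAscent.FibrewiseClosedPoints`),
line `registered`: the INSTANCE stub `stub_oneShotCurves` = `OneShot p 2`, strong one-shot resolution
of affine curves with exact support (the `d = 1` instance of the crux's conclusion).

For an integral algebra `A` of finite type over a field with `dim A ≤ 1`, let `F = Frac A`, let
`Ã ⊆ F` be the integral closure (a finite `A`-module by E. Noether's theorem, tree
`NoetherFiniteIntegralClosure_holds`; a Dedekind domain, tree `isDedekindDomain_integralClosure`) and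
let `𝔣 = {r ∈ A | r Ã ⊆ A}` be the **conductor**. Then

* `𝔣 ≠ 0` (a common denominator of finitely many module generators of `Ã` lies in `𝔣`);
* `Bl_𝔣(Spec A) = Proj A[𝔣t]` is a regular scheme: the chart ring `A[𝔣/a] ≅ (A[𝔣t])_{(at)}`
  (`0 ≠ a ∈ 𝔣`) contains `Ã` (`b = (ab)/a`) and lies in `Ã[1/a]`; a ring `B` with
  `Ã ⊆ B ⊆ Ã[1/a]`, `Ã` Dedekind, has all its local rings equal to local rings of `Ã`
  (`isRegularRing_of_dedekind` of the companion file `…OneShotCurvesDedekind`: if `aⁿ z = x` then,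
  `(aⁿ, x)` being an invertible ideal, `aⁿ = aⁿ w + x w'` with `x w, x w' ∈ (aⁿ)`, which exhibits `z`
  as a fraction with denominator outside any given prime), hence is regular; so the Noetherian chart
  rings are regular rings and the blowing up is regular (`Scheme.isRegular_Spec`, chart cover);
* EXACT SUPPORT `𝔣 ⊆ 𝔭 ↔ A_𝔭` not regular: if `a ∈ 𝔣 ∖ 𝔭` then `Ã ⊆ A_𝔭 ⊆ F` and `A_𝔭` is a
  localization of `Ã`, hence regular; if `𝔣 ⊆ 𝔭` and `A_𝔭` were regular it would be integrally
  closed (tree `isIntegrallyClosed_of_isRegularLocalRing`), so `Ã ⊆ A_𝔭` and a common denominator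
  `s ∉ 𝔭` of the generators of `Ã` would lie in `𝔣 ⊆ 𝔭`.

The case `dim A = 0` (`A` a field, `Ã = A`, `𝔣 = A`) is covered by the same argument.

References: O. Zariski, P. Samuel, *Commutative Algebra* II, Ch. V §5 (conductor); J.-P. Serre,
*Groupes algébriques et corps de classes*, IV §1 (normalisation of curves and the conductor);
The Stacks Project, Tag 0804 (affine blowup algebras), Tag 034X (normal ⇔ regular in dimension 1).
-/

-- single-problem summit: the doubled namespace component is forced
set_option linter.dupNamespace false
-- Mathlib is built with this depth; the default (1) makes instance search on the chart rings fail
set_option maxSynthPendingDepth 3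

noncomputable section

namespace Summit.ResolutionOfSingularities.ResolutionOfSingularities.Theorems.SectionAscent.OneShotCurves

open AlgebraicGeometry IsLocalRing Literature.AlgebraicGeometry.Resolution

/-! ## The conductor of `A` in its normalisation -/

/-- **The conductor exists** as an ideal of `A`: `𝔣 = {r ∈ A | r Ã ⊆ A}`, `Ã` the integral closure
of `A` in `F = Frac A` (realised as the colon ideal `(A : Ã)` of `A`-submodules of `F`).
[folklore] -/
theorem exists_conductor {A : Type*} [CommRing A] {F : Type*} [Field F] [Algebra A F] :
    ∃ 𝔣 : Ideal A, ∀ r, r ∈ 𝔣 ↔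
      ∀ b ∈ integralClosure A F, ∃ c, algebraMap A F c = algebraMap A F r * b := by
  refine ⟨(1 : Submodule A F).colon (integralClosure A F : Set F), fun r => ?_⟩
  simp only [Submodule.mem_colon, SetLike.mem_coe, Submodule.mem_one, Algebra.smul_def]

/-- A finite normalisation has a finite set of `A`-module generators. [folklore] -/
theorem exists_finset_span {A : Type*} [CommRing A] {F : Type*} [Field F] [Algebra A F]
    (hfin : Module.Finite A (integralClosure A F)) :
    ∃ G : Finset F, Submodule.span A (G : Set F) = Subalgebra.toSubmodule (integralClosure A F) :=
  Module.Finite.iff_fg.mp hfin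

/-- An element multiplying a set of `A`-module generators of `Ã` into `A` lies in the conductor.
[folklore] -/
theorem mem_conductor_of_span {A : Type*} [CommRing A] {F : Type*} [Field F] [Algebra A F]
    {𝔣 : Ideal A}
    (h𝔣 : ∀ r, r ∈ 𝔣 ↔ ∀ b ∈ integralClosure A F, ∃ c, algebraMap A F c = algebraMap A F r * b)
    {G : Set F} (hG : Submodule.span A G = Subalgebra.toSubmodule (integralClosure A F)) {s : A}
    (hs : ∀ g ∈ G, ∃ c, algebraMap A F c = algebraMap A F s * g) : s ∈ 𝔣 := by
  refine (h𝔣 s).mpr fun b hb => ?_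
  rw [← Subalgebra.mem_toSubmodule, ← hG] at hb
  induction hb using Submodule.span_induction with
  | mem g hg => exact hs g hg
  | zero => exact ⟨0, by rw [map_zero, mul_zero]⟩
  | add x y _ _ hx hy =>
    obtain ⟨c₁, hc₁⟩ := hx
    obtain ⟨c₂, hc₂⟩ := hy
    exact ⟨c₁ + c₂, by rw [map_add, hc₁, hc₂, mul_add]⟩
  | smul r x _ hx =>
    obtain ⟨c, hc⟩ := hx
    exact ⟨r * c, by rw [map_mul, hc, Algebra.smul_def, mul_left_comm]⟩

/-- **The conductor of a domain with finite normalisation is nonzero**: a common denominator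
`d ≠ 0` of finitely many `A`-module generators of `Ã ⊆ Frac A` lies in `𝔣`. [folklore] -/
theorem conductor_ne_bot {A : Type*} [CommRing A] [IsDomain A] {F : Type*} [Field F]
    [Algebra A F] [IsFractionRing A F] {𝔣 : Ideal A}
    (h𝔣 : ∀ r, r ∈ 𝔣 ↔ ∀ b ∈ integralClosure A F, ∃ c, algebraMap A F c = algebraMap A F r * b)
    (hfin : Module.Finite A (integralClosure A F)) : 𝔣 ≠ ⊥ := by
  obtain ⟨G, hG⟩ := exists_finset_span hfin
  obtain ⟨⟨d, hd⟩, hdG⟩ :=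
    IsLocalization.exist_integer_multiples_of_finite (nonZeroDivisors A) (fun g : G => (g : F))
  have hd𝔣 : d ∈ 𝔣 := by
    refine mem_conductor_of_span h𝔣 hG fun g hg => ?_
    obtain ⟨c, hc⟩ := hdG ⟨g, hg⟩
    exact ⟨c, by rw [hc, Algebra.smul_def]⟩
  intro h
  rw [h, Ideal.mem_bot] at hd𝔣
  exact nonZeroDivisors.ne_zero hd hd𝔣

/-! ## Exact support: `V(𝔣)` is the singular locus -/

/-- **A local ring of `A` at a prime containing the conductor is not regular** (finite
normalisation): a regular `A_𝔭` is an integrally closed domain, so `Ã ⊆ A_𝔭 ⊆ Frac A`, and a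
common denominator `s ∉ 𝔭` of the generators of `Ã` would lie in `𝔣 ⊆ 𝔭`. [folklore] -/
theorem not_isRegularLocalRing_of_conductor_le {A : Type*} [CommRing A] [IsDomain A]
    {F : Type*} [Field F] [Algebra A F] [IsFractionRing A F] {𝔣 : Ideal A}
    (h𝔣 : ∀ r, r ∈ 𝔣 ↔ ∀ b ∈ integralClosure A F, ∃ c, algebraMap A F c = algebraMap A F r * b)
    (hfin : Module.Finite A (integralClosure A F)) (𝔭 : PrimeSpectrum A) (hle : 𝔣 ≤ 𝔭.asIdeal) :
    ¬ IsRegularLocalRing (Localization.AtPrime 𝔭.asIdeal) := by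
  intro hreg
  obtain ⟨L, _instL⟩ : ∃ L : Subalgebra A F, IsLocalization.AtPrime L 𝔭.asIdeal :=
    ⟨_, Localization.subalgebra.isLocalization_ofField F _ 𝔭.asIdeal.primeCompl_le_nonZeroDivisors⟩
  haveI : IsRegularLocalRing L := IsRegularLocalRing.of_ringEquiv
    (IsLocalization.algEquiv 𝔭.asIdeal.primeCompl (Localization.AtPrime 𝔭.asIdeal) L).toRingEquiv
  haveI : IsIntegrallyClosed L := isIntegrallyClosed_of_isRegularLocalRing L
  -- `Ã ⊆ L`
  have hÃL : ∀ b ∈ integralClosure A F, b ∈ L := by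
    intro b hb
    have hb' : IsIntegral L b := IsIntegral.tower_top (A := L) (show IsIntegral A b from hb)
    obtain ⟨y, hy⟩ := IsIntegrallyClosed.isIntegral_iff.mp hb'
    rw [← hy]
    exact y.2
  obtain ⟨G, hG⟩ := exists_finset_span hfin
  have hGL : ∀ g ∈ G, (g : F) ∈ L := fun g hg =>
    hÃL g (by rw [← Subalgebra.mem_toSubmodule, ← hG]; exact Submodule.subset_span hg)
  obtain ⟨⟨s, hs⟩, hsG⟩ := IsLocalization.exist_integer_multiples_of_finite 𝔭.asIdeal.primeCompl
    (fun g : G => (⟨(g : F), hGL g.1 g.2⟩ : L))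
  have hs𝔣 : s ∈ 𝔣 := by
    refine mem_conductor_of_span h𝔣 hG fun g hg => ?_
    obtain ⟨c, hc⟩ := hsG ⟨g, hg⟩
    refine ⟨c, ?_⟩
    have := congrArg (fun y : L => (y : F)) hc
    simp only [Subalgebra.coe_algebraMap, Subalgebra.coe_smul] at this
    rw [this, Algebra.smul_def]
  exact hs (hle hs𝔣)

/-- **A local ring of `A` at a prime not containing the conductor is regular** (`Ã` Dedekind): for
`a ∈ 𝔣 ∖ 𝔭` one has `Ã ⊆ A_𝔭 ⊆ Frac A` (`b = (ab)/a`), so `A_𝔭` is a ring of fractions of the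
Dedekind domain `Ã`, hence a regular local ring (`isRegularLocalRing_of_dedekind`). [folklore] -/
theorem isRegularLocalRing_of_not_conductor_le {A : Type*} [CommRing A] [IsDomain A]
    {F : Type*} [Field F] [Algebra A F] [IsFractionRing A F] {𝔣 : Ideal A}
    (h𝔣 : ∀ r, r ∈ 𝔣 ↔ ∀ b ∈ integralClosure A F, ∃ c, algebraMap A F c = algebraMap A F r * b)
    (hded : IsDedekindDomain (integralClosure A F)) (𝔭 : PrimeSpectrum A)
    (hle : ¬ 𝔣 ≤ 𝔭.asIdeal) : IsRegularLocalRing (Localization.AtPrime 𝔭.asIdeal) := by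
  obtain ⟨a, ha𝔣, ha𝔭⟩ : ∃ a ∈ 𝔣, a ∉ 𝔭.asIdeal := Set.not_subset.mp hle
  obtain ⟨L, _instL⟩ : ∃ L : Subalgebra A F, IsLocalization.AtPrime L 𝔭.asIdeal :=
    ⟨_, Localization.subalgebra.isLocalization_ofField F _ 𝔭.asIdeal.primeCompl_le_nonZeroDivisors⟩
  haveI : IsLocalRing L := IsLocalization.AtPrime.isLocalRing L 𝔭.asIdeal
  -- `Ã ⊆ L`
  have hu : IsUnit (algebraMap A L a) :=
    IsLocalization.map_units L (⟨a, ha𝔭⟩ : 𝔭.asIdeal.primeCompl)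
  have hÃL : integralClosure A F ≤ L := by
    intro b hb
    obtain ⟨c, hc⟩ := (h𝔣 a).mp ha𝔣 b hb
    obtain ⟨v, hv⟩ := hu
    have hva : ((v⁻¹ : Lˣ) : L) * algebraMap A L a = 1 := by rw [← hv, Units.inv_mul]
    have hvaF : (((v⁻¹ : Lˣ) : L) : F) * algebraMap A F a = 1 := by
      have := congrArg (fun y : L => (y : F)) hva
      simpa only [Subalgebra.coe_mul, Subalgebra.coe_algebraMap, Subalgebra.coe_one] using this
    have hb_eq : b = (((v⁻¹ : Lˣ) : L) : F) * algebraMap A F c := by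
      rw [hc, ← mul_assoc, hvaF, one_mul]
    rw [hb_eq]
    exact L.mul_mem (v⁻¹ : Lˣ).1.2 (L.algebraMap_mem c)
  haveI := hded
  haveI : IsRegularLocalRing L := by
    refine isRegularLocalRing_of_dedekind (Subalgebra.inclusion hÃL).toRingHom
      (Subalgebra.inclusion_injective hÃL) fun z => ?_
    obtain ⟨⟨c, s⟩, h⟩ := IsLocalization.surj 𝔭.asIdeal.primeCompl z
    refine ⟨algebraMap A _ s, algebraMap A _ c, ?_, ?_⟩
    · change IsUnit (Subalgebra.inclusion hÃL (algebraMap A _ s))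
      rw [AlgHom.commutes]
      exact IsLocalization.map_units L s
    · change Subalgebra.inclusion hÃL (algebraMap A _ s) * z =
        Subalgebra.inclusion hÃL (algebraMap A _ c)
      rw [AlgHom.commutes, AlgHom.commutes, mul_comm]
      exact h
  exact IsRegularLocalRing.of_ringEquiv
    (IsLocalization.algEquiv 𝔭.asIdeal.primeCompl L (Localization.AtPrime 𝔭.asIdeal)).toRingEquiv

/-! ## The blowing up of the conductor is regular -/

/-- **The chart rings of `Bl_𝔣(Spec A)` are regular rings** (`Ã` Dedekind, `0 ≠ a ∈ 𝔣`): the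
chart ring `(A[𝔣t])_{(at)} ≅ A[𝔣/a] ⊆ A[1/a] ⊆ Frac A` is a Noetherian domain containing `Ã`
(`b = (ab)/a` with `ab ∈ 𝔣`) and contained in `Ã[1/a]`, so `isRegularRing_of_dedekind` applies.
[folklore] -/
theorem isRegularRing_chart {A : Type*} [CommRing A] [IsDomain A] [IsNoetherianRing A]
    {F : Type*} [Field F] [Algebra A F] [IsFractionRing A F] {𝔣 : Ideal A}
    (h𝔣 : ∀ r, r ∈ 𝔣 ↔ ∀ b ∈ integralClosure A F, ∃ c, algebraMap A F c = algebraMap A F r * b)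
    (hded : IsDedekindDomain (integralClosure A F)) {a : A} (ha : a ∈ 𝔣) (ha0 : a ≠ 0) :
    IsRegularRing (HomogeneousLocalization.Away (reesGrading 𝔣) (reesT a ha)) := by
  haveI := FInjectiveMacaulayfication.ReesChartRing.isNoetherianRing_away a ha
  haveI := FInjectiveMacaulayfication.ReesChartRing.isDomain_away a ha ha0
  haveI := hded
  have hinjF : Function.Injective (algebraMap A F) := IsFractionRing.injective A F
  have haF : algebraMap A F a ≠ 0 := (map_ne_zero_iff _ hinjF).mpr ha0
  have hunit : IsUnit (algebraMap A F a) := isUnit_iff_ne_zero.mpr haF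
  -- `j : A[1/a] → F`, injective
  set j : Localization.Away a →+* F := IsLocalization.Away.lift a (g := algebraMap A F) hunit
    with hj
  have hjalg : ∀ r, j (algebraMap A (Localization.Away a) r) = algebraMap A F r := fun r =>
    IsLocalization.Away.lift_eq a hunit r
  have hjinj : Function.Injective j := by
    rw [injective_iff_map_eq_zero]
    intro z hz
    obtain ⟨⟨r, s⟩, h⟩ := IsLocalization.surj (Submonoid.powers a) z
    have h' := congrArg j h
    rw [map_mul, hz, zero_mul, hjalg, eq_comm, map_eq_zero_iff _ hinjF] at h'
    rw [h', map_zero] at h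
    exact ((IsLocalization.map_units (Localization.Away a) s).mul_left_eq_zero).mp h
  have hjdiv : ∀ c : A, j (algebraMap A (Localization.Away a) c * IsLocalization.Away.invSelf a) *
      algebraMap A F a = algebraMap A F c := by
    intro c
    rw [← hjalg a, ← map_mul, div_mul_algebraMap, hjalg]
  -- `ψ : (A[𝔣t])_{(at)} → F`, injective, with `Ã` in its range
  set ψ : HomogeneousLocalization.Away (reesGrading 𝔣) (reesT a ha) →+* F :=
    j.comp (reesChart a ha) with hψ
  have hψinj : Function.Injective ψ := hjinj.comp (reesChart_injective a ha)
  have hrange : ∀ b ∈ integralClosure A F, ∃ z, ψ z = b := by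
    intro b hb
    obtain ⟨c, hc⟩ := (h𝔣 a).mp ha b hb
    have hc𝔣 : c ∈ 𝔣 := by
      refine (h𝔣 c).mpr fun b' hb' => ?_
      obtain ⟨c', hc'⟩ := (h𝔣 a).mp ha (b * b') (Subalgebra.mul_mem _ hb hb')
      exact ⟨c', by rw [hc', hc, mul_assoc]⟩
    refine ⟨(reesChartEquiv a ha).symm ⟨_, div_mem_blowupAlgebra 𝔣 a hc𝔣⟩, ?_⟩
    rw [hψ, RingHom.comp_apply, ← coe_reesChartEquiv, RingEquiv.apply_symm_apply]
    refine mul_right_cancel₀ haF ?_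
    rw [hjdiv, hc, mul_comm]
  obtain ⟨φ, hφinj, hφψ⟩ := exists_ringHom_of_le_range ψ hψinj (integralClosure A F) hrange
  -- the chart ring lies in `Ã[1/a]`
  have ha' : algebraMap A (integralClosure A F) a ≠ 0 := by
    intro h
    apply ha0
    apply hinjF
    rw [map_zero]
    exact congrArg Subtype.val h
  have hgen : ∀ v ∈ blowupAlgebra 𝔣 a, ∃ (n : ℕ) (c : A),
      algebraMap A F a ^ n * j v = algebraMap A F c := by
    intro v hv
    unfold blowupAlgebra at hv
    induction hv using Algebra.adjoin_induction with
    | mem v hv =>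
      obtain ⟨x, hx, rfl⟩ := hv
      exact ⟨1, x, by rw [pow_one, mul_comm, hjdiv]⟩
    | algebraMap r => exact ⟨0, r, by rw [pow_zero, one_mul, hjalg]⟩
    | add v₁ v₂ _ _ h₁ h₂ =>
      obtain ⟨n₁, c₁, h₁⟩ := h₁
      obtain ⟨n₂, c₂, h₂⟩ := h₂
      refine ⟨n₁ + n₂, a ^ n₂ * c₁ + a ^ n₁ * c₂, ?_⟩
      rw [map_add, map_add, map_mul, map_mul, map_pow, map_pow, ← h₁, ← h₂]
      ring
    | mul v₁ v₂ _ _ h₁ h₂ =>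
      obtain ⟨n₁, c₁, h₁⟩ := h₁
      obtain ⟨n₂, c₂, h₂⟩ := h₂
      refine ⟨n₁ + n₂, c₁ * c₂, ?_⟩
      rw [map_mul, map_mul, ← h₁, ← h₂]
      ring
  have hB : ∀ z : HomogeneousLocalization.Away (reesGrading 𝔣) (reesT a ha),
      ∃ (n : ℕ) (x : integralClosure A F), φ (algebraMap A _ a) ^ n * z = φ x := by
    intro z
    have hz : reesChart a ha z ∈ blowupAlgebra 𝔣 a := by
      rw [← SetLike.mem_coe, ← range_reesChart a ha]; exact ⟨z, rfl⟩
    obtain ⟨n, c, hc⟩ := hgen _ hz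
    refine ⟨n, algebraMap A _ c, hψinj ?_⟩
    rw [map_mul, map_pow, hφψ, hφψ, Subalgebra.coe_algebraMap, Subalgebra.coe_algebraMap, ← hc]
    rfl
  exact isRegularRing_of_dedekind φ hφinj ha' hB

/-- **The blowing up of `Spec A` along its conductor is a regular scheme** (`Ã` Dedekind): it is
covered by the charts `D₊(at) = Spec (A[𝔣t])_{(at)}`, `0 ≠ a ∈ 𝔣`, spectra of regular rings
(`isRegularRing_chart`, `Scheme.isRegular_Spec`). [folklore] -/
theorem isRegular_affineBlowup_conductor {A : Type*} [CommRing A] [IsDomain A]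
    [IsNoetherianRing A] {F : Type*} [Field F] [Algebra A F] [IsFractionRing A F] {𝔣 : Ideal A}
    (h𝔣 : ∀ r, r ∈ 𝔣 ↔ ∀ b ∈ integralClosure A F, ∃ c, algebraMap A F c = algebraMap A F r * b)
    (hded : IsDedekindDomain (integralClosure A F)) : Scheme.IsRegular (affineBlowup 𝔣) := by
  refine Scheme.IsRegular.of_forall_exists_isOpenImmersion fun y => ?_
  have hy : y ∈ (⨆ b : 𝔣, Proj.basicOpen (reesGrading 𝔣) (reesT (I := 𝔣) b.1 b.2)) := by
    rw [affineBlowup.iSup_basicOpen_reesT_eq_top 𝔣]; trivial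
  obtain ⟨⟨a, ha⟩, hya⟩ := TopologicalSpace.Opens.mem_iSup.mp hy
  have ha0 : a ≠ 0 := by
    rintro rfl
    have h0 : reesT (I := 𝔣) 0 ha = 0 := Subtype.ext (by rw [coe_reesT, map_zero]; rfl)
    rw [h0, Proj.basicOpen_zero] at hya
    exact hya
  haveI : IsRegularRing (CommRingCat.of (HomogeneousLocalization.Away (reesGrading 𝔣) (reesT a ha))) :=
    isRegularRing_chart h𝔣 hded ha ha0
  refine ⟨_, Proj.awayι (reesGrading 𝔣) (reesT a ha) (reesT_mem a ha) Nat.one_pos, inferInstance, ?_,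
    Scheme.isRegular_Spec _⟩
  rw [← Scheme.Hom.coe_opensRange, Proj.opensRange_awayι]
  exact hya

/-! ## The stub -/

/-- STUB `stub_oneShotCurves` of line `registered` (crux `SectionAscent.FibrewiseClosedPoints`):
**strong one-shot resolution of affine curves with exact support** (`OneShot p 2`). For an integral
algebra `A` of finite type over a field of characteristic `p` with `dim A < 2`, the conductor
`𝔣 ≠ 0` of `A` in its (finite, Dedekind) normalisation has regular blowing up `Bl_𝔣(Spec A)`, and
`V(𝔣)` is exactly the non-regular locus of `Spec A`. [folklore] -/
theorem stub_oneShotCurves (p : ℕ) (hp : p.Prime) (K : Type) [Field K] [CharP K p] (A : Type)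
    [CommRing A] [IsDomain A] [Algebra K A] [Algebra.FiniteType K A]
    (hdim : ringKrullDim A < ((2 : ℕ) : WithBot ℕ∞)) :
    ∃ I : Ideal A, I ≠ ⊥ ∧
      Literature.AlgebraicGeometry.Resolution.Scheme.IsRegular
        (Literature.AlgebraicGeometry.Resolution.affineBlowup I) ∧
      ∀ 𝔭 : PrimeSpectrum A, I ≤ 𝔭.asIdeal ↔ ¬ IsRegularLocalRing (Localization.AtPrime 𝔭.asIdeal) := by
  have _hp := hp
  haveI : IsNoetherianRing A := Algebra.FiniteType.isNoetherianRing K A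
  haveI : Ring.DimensionLEOne A := Ring.DimensionLEOne.of_ringKrullDim_le_one (Order.le_of_lt_succ hdim)
  have hfin : Module.Finite A (integralClosure A (FractionRing A)) :=
    NoetherFiniteIntegralClosure_holds.self K A (FractionRing A)
  have hded : IsDedekindDomain (integralClosure A (FractionRing A)) :=
    isDedekindDomain_integralClosure A (FractionRing A) hfin
  obtain ⟨𝔣, h𝔣⟩ := exists_conductor (A := A) (F := FractionRing A)
  refine ⟨𝔣, conductor_ne_bot h𝔣 hfin, isRegular_affineBlowup_conductor h𝔣 hded, fun 𝔭 => ⟨?_, ?_⟩⟩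
  · exact not_isRegularLocalRing_of_conductor_le h𝔣 hfin 𝔭
  · intro h
    by_contra hle
    exact h (isRegularLocalRing_of_not_conductor_le h𝔣 hded 𝔭 hle)

end Summit.ResolutionOfSingularities.ResolutionOfSingularities.Theorems.SectionAscent.OneShotCurves

end
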